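import Mathlib
import HarnessLib
import Summits.HubbardSuperconductivity.HubbardSuperconductivity.Theorems.KLProgrammeKLRegimeEngineTwoShellFrameWitness

/-!
# Route `KLProgramme` — ENGINE child (stmt-HubbardSuperconductivity-20437 `KLRegimeEngineV17F2`): THE DEFERRED TWO-SHELL PACKAGE IS ADMISSIBLE —
# `TwoShellFrameAreaAt klTS klTSU` unconditionally (the U12b row of the rev-13 image; design note HOME/hubbard-kl-k3c2-p2/TWO-SHELL-FRAME-PORT.md §11)

Cell `gate-hubbard-kl`, seat hubbard-kl-k3c2-p2 g15.  `exists_twoShellFrameAreaAt` (…EngineTwoShellFrameWitness) fed to `twoShellFrameAreaAt_klTwoShellPack`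
(…EngineV8DefsG11): **`twoShellFrameAreaAt_klTS`** — the engine's deferred pair `(klTS, klTSU)` satisfies its defining predicate, with no hypothesis.
Everything is PROVED; no definitions, no named facts; nothing asserts any stub or superconductivity.
References: DECOMP App. E Lemmas E.1/E.3; FST II App. B [cite: FeldmanSalmhoferTrubowitz1998].
-/

noncomputable section

namespace Summit.HubbardSuperconductivity.HubbardSuperconductivity.Theorems.EngineV8

set_option linter.dupNamespace false -- summit = problem name (single-conjunct summit), D-0017

open Summit.HubbardSuperconductivity.HubbardSuperconductivity.Theorems.KLRegimeSplit

/-- **The deferred two-shell package of the engine is admissible**: `TwoShellFrameAreaAt klTS klTSU` (the `dif` of `klTwoShellPack` takes its `then` branch by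
`exists_twoShellFrameAreaAt`). [cite: FeldmanSalmhoferTrubowitz1998, App. B] -/
theorem twoShellFrameAreaAt_klTS : TwoShellFrameAreaAt klTS klTSU := by
  obtain ⟨Au, hA, hu, h⟩ := exists_twoShellFrameAreaAt
  exact twoShellFrameAreaAt_klTwoShellPack hA hu h

end Summit.HubbardSuperconductivity.HubbardSuperconductivity.Theorems.EngineV8

end
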